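import Mathlib
import HarnessLib
import Summits.QuantumFields.YangMills.Theorems.ParabolicTrajectoryContinuumLimitOnTrajectoryStubAxisSymmetry
import Summits.QuantumFields.YangMills.Theorems.ParabolicTrajectoryContinuumLimitOnTrajectoryStubTranslB
import Summits.QuantumFields.YangMills.Theorems.LangevinControlUVOSLegsFromFemtoAndGapStubUpgrade
import Summits.QuantumFields.YangMills.Theorems.PencilRigidityPlanarToEuclideanSO4
import Literature.MathematicalPhysics.QuantumLattice.SchwingerGrowthTwoFactor
import Literature.MathematicalPhysics.QuantumFieldTheory.SchwingerLimitInheritance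

/-!
# `ContinuumLegGivenGap` (stmt-QuantumFields-15828), line `Sketch` (reshape 16): `stub_rotOfPythagorean` — (ROT) from ONE rotation

Support file for the crux item stmt-QuantumFields-15828 (registered glue stub `stub_rotOfPythagorean` of line `Sketch`,
reshape 16). The UV stub's asymptotic proper-rotation invariance (ROT) of the canonical curvature distributions on `⁰𝒮`
is DERIVED from asymptotic invariance under the SINGLE Pythagorean rotation `ρ_θ` of the `(x⁰,x¹)`-plane
(`cos θ = 3/5`, `sin θ = 4/5`, stated on the axis vectors), route ParabolicTrajectory's `UUVB` and two landed glue
statements (`stub_rotNiven`, `stub_rotHyper`, hypotheses here):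
* `P R := ∀ p F, IsOffDiagonal F → 𝓓_k(R·F) − 𝓓_k(F) → 0` is a group predicate (`pred_mul`, `pred_symm`, `pred_refl`;
  LangevinControlUV's `isOffDiagonal_linActMulti`, `linActMulti_trans_eq`, `linActMulti_refl_eq`);
* coordinate permutations are EXACT symmetries (route ParabolicTrajectory's landed `stub_axisSymmetry`), hence in `P`;
* the angle set `{t | P (ρ_t)}` is CLOSED (`isClosed_angleSet`): the k-uniform E0′ bound of `UUVB`
  (`Transl.norm_curvDistribution_le_of_uuvb`) and the continuity of the rotation orbit of a test function in `𝓢`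
  (`continuous_linActMulti_rho`) make `t ↦ P (ρ_t)` closed under limits;
* `θ` is in the angle set by (ROT₃₄₅) (`rho_e0 … rho_e3` identify `ρ_θ` on the axis vectors), so `stub_rotNiven` gives
  every `ρ_t`, `stub_rotHyper` every signed permutation, and the landed Givens generation
  `PlanarToEuclidean.so4_generation` with `planar_of_rho` every determinant-one isometry. [folklore]
-/

noncomputable section

namespace Summit.QuantumFields.YangMills.Theorems.ContinuumLegGivenGap

open scoped SchwartzMap
open Filter Topology MeasureTheory
open Literature.MathematicalPhysics.QuantumFieldTheory Literature.MathematicalPhysics.QuantumLattice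
  Literature.MathematicalPhysics.AQFT Literature.Probability.LatticeModels
open Summit.QuantumFields.YangMills.Cruxes.ContinuumLimitOnTrajectory.TwoOrbitSynchronisation
  (curvDistribution curvDistribution_sub UUVB PlaqIdx stub_axisSymmetry)
open Summit.QuantumFields.YangMills.Cruxes.ContinuumLimitOnTrajectory.TwoOrbitSynchronisation.Transl
  (norm_curvDistribution_le_of_uuvb)
open Summit.QuantumFields.YangMills.Theorems.OSLegsFromFemtoAndGap.Upgrade
  (isOffDiagonal_linActMulti linActMulti_trans_eq linActMulti_refl_eq continuous_linActMulti_rho planar_of_rho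
   rho_e0 rho_e1 rho_e2 rho_e3 exists_cos_eq_and_sin_eq_neg)

section Pred

variable {G : Type} [Group G] [TopologicalSpace G] [IsTopologicalGroup G] [CompactSpace G]
  [MeasurableSpace G] [BorelSpace G] (r : LatticeRep G) (sch : SpeciesScheme (YMSpecies G))

/-! ## §1 The asymptotic-invariance predicate is a group predicate -/

/-- Composition: if `A` and `B` are asymptotic symmetries on `⁰𝒮` then so is `A.trans B`
(`(A.trans B)·F = B·(A·F)`, `⁰𝒮` is stable under the action). [folklore] -/
theorem pred_mul {A B : EuclideanSpace ℝ (Fin 4) ≃ₗᵢ[ℝ] EuclideanSpace ℝ (Fin 4)}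
    (hA : ∀ (p : ℕ) (F : 𝓢((Fin p → EuclideanSpace ℝ (Fin 4)), ℂ)), IsOffDiagonal F →
      Tendsto (fun k : ℕ => curvDistribution r sch k p (linActMulti A F) - curvDistribution r sch k p F) atTop (𝓝 0))
    (hB : ∀ (p : ℕ) (F : 𝓢((Fin p → EuclideanSpace ℝ (Fin 4)), ℂ)), IsOffDiagonal F →
      Tendsto (fun k : ℕ => curvDistribution r sch k p (linActMulti B F) - curvDistribution r sch k p F) atTop (𝓝 0))
    (p : ℕ) (F : 𝓢((Fin p → EuclideanSpace ℝ (Fin 4)), ℂ)) (hF : IsOffDiagonal F) :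
    Tendsto (fun k : ℕ => curvDistribution r sch k p (linActMulti (A.trans B) F) - curvDistribution r sch k p F)
      atTop (𝓝 0) := by
  have h := (hB p (linActMulti A F) (isOffDiagonal_linActMulti A hF)).add (hA p F hF)
  rw [add_zero] at h
  refine h.congr fun k => ?_
  rw [linActMulti_trans_eq]; ring

/-- Inverses: if `A` is an asymptotic symmetry on `⁰𝒮` then so is `A.symm`. [folklore] -/
theorem pred_symm {A : EuclideanSpace ℝ (Fin 4) ≃ₗᵢ[ℝ] EuclideanSpace ℝ (Fin 4)}
    (hA : ∀ (p : ℕ) (F : 𝓢((Fin p → EuclideanSpace ℝ (Fin 4)), ℂ)), IsOffDiagonal F →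
      Tendsto (fun k : ℕ => curvDistribution r sch k p (linActMulti A F) - curvDistribution r sch k p F) atTop (𝓝 0))
    (p : ℕ) (F : 𝓢((Fin p → EuclideanSpace ℝ (Fin 4)), ℂ)) (hF : IsOffDiagonal F) :
    Tendsto (fun k : ℕ => curvDistribution r sch k p (linActMulti A.symm F) - curvDistribution r sch k p F)
      atTop (𝓝 0) := by
  have h := (hA p (linActMulti A.symm F) (isOffDiagonal_linActMulti A.symm hF)).neg
  rw [neg_zero] at h
  refine h.congr fun k => ?_
  rw [← linActMulti_trans_eq, LinearIsometryEquiv.symm_trans_self, linActMulti_refl_eq]; ring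

/-- The identity is an asymptotic symmetry. [folklore] -/
theorem pred_refl (p : ℕ) (F : 𝓢((Fin p → EuclideanSpace ℝ (Fin 4)), ℂ)) :
    Tendsto (fun k : ℕ => curvDistribution r sch k p (linActMulti (LinearIsometryEquiv.refl ℝ (EuclideanSpace ℝ (Fin 4))) F) -
      curvDistribution r sch k p F) atTop (𝓝 0) := by
  simp_rw [linActMulti_refl_eq, sub_self]
  exact tendsto_const_nhds

/-- Coordinate permutations are EXACT symmetries of the canonical curvature distributions (route ParabolicTrajectory's
landed `stub_axisSymmetry`), hence asymptotic ones. [folklore] -/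
theorem pred_perm (σ : Equiv.Perm (Fin 4)) (p : ℕ) (F : 𝓢((Fin p → EuclideanSpace ℝ (Fin 4)), ℂ)) :
    Tendsto (fun k : ℕ => curvDistribution r sch k p (linActMulti (LinearIsometryEquiv.piLpCongrLeft 2 ℝ ℝ σ) F) -
      curvDistribution r sch k p F) atTop (𝓝 0) := by
  simp_rw [stub_axisSymmetry G r sch _ p σ F, sub_self]
  exact tendsto_const_nhds

/-! ## §2 The angle set is closed (equicontinuity from the k-uniform E0′ bound) -/

/-- **The angle set of the asymptotic-invariance predicate along the `(x⁰,x¹)`-rotations is closed.** With the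
k-uniform E0′ bound of `UUVB` (ONE threshold in `k` for all test functions) and the continuity of
`t ↦ ρ_t · F` in `𝓢`, a limit `t₀` of angles `t` with `P(ρ_t)` has `P(ρ_{t₀})`:
`‖𝓓(ρ_{t₀}F) − 𝓓F‖ ≤ K |ρ_{t₀}F − ρ_tF| + ‖𝓓(ρ_tF) − 𝓓F‖`. [folklore] -/
theorem isClosed_angleSet (hU : UUVB r sch) :
    IsClosed {t : ℝ | ∀ (p : ℕ) (F : 𝓢((Fin p → EuclideanSpace ℝ (Fin 4)), ℂ)), IsOffDiagonal F →
      Tendsto (fun k : ℕ => curvDistribution r sch k p (linActMulti (planeRot (0 : Fin 3) t) F) -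
        curvDistribution r sch k p F) atTop (𝓝 0)} := by
  obtain ⟨s, α, β, hb⟩ := norm_curvDistribution_le_of_uuvb r sch hU
  refine isClosed_of_closure_subset fun t₀ ht₀ p F hF => ?_
  rw [Metric.tendsto_nhds]
  intro ε hε
  -- the k-uniform constant for arity `p`
  set K : ℝ := |(Fintype.card PlaqIdx : ℝ) ^ p * (α * (p.factorial : ℝ) ^ β)| with hK
  -- continuity of the rotation orbit in the Schwartz norm
  have hcont : Continuous fun t : ℝ => K * schwartzNorm (p * s)
      (linActMulti (planeRot (0 : Fin 3) t₀) F - linActMulti (planeRot (0 : Fin 3) t) F) :=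
    continuous_const.mul ((continuous_schwartzNorm _).comp
      (continuous_const.sub (continuous_linActMulti_rho F)))
  have h0 : K * schwartzNorm (p * s)
      (linActMulti (planeRot (0 : Fin 3) t₀) F - linActMulti (planeRot (0 : Fin 3) t₀) F) < ε / 3 := by
    have hz : schwartzNorm (p * s) (0 : 𝓢((Fin p → EuclideanSpace ℝ (Fin 4)), ℂ)) = 0 := map_zero _
    rw [sub_self, hz, mul_zero]; positivity
  have hnhds : {t : ℝ | K * schwartzNorm (p * s)
      (linActMulti (planeRot (0 : Fin 3) t₀) F - linActMulti (planeRot (0 : Fin 3) t) F) < ε / 3} ∈ 𝓝 t₀ :=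
    (isOpen_lt hcont continuous_const).mem_nhds h0
  obtain ⟨t, ht, htS⟩ := mem_closure_iff_nhds.1 ht₀ _ hnhds
  have htS' := htS p F hF
  rw [Metric.tendsto_nhds] at htS'
  have hoff1 : IsOffDiagonal (linActMulti (planeRot (0 : Fin 3) t₀) F) := isOffDiagonal_linActMulti _ hF
  have hoff2 : IsOffDiagonal (linActMulti (planeRot (0 : Fin 3) t) F) := isOffDiagonal_linActMulti _ hF
  have hoff : IsOffDiagonal (linActMulti (planeRot (0 : Fin 3) t₀) F - linActMulti (planeRot (0 : Fin 3) t) F) :=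
    hoff1.sub hoff2
  filter_upwards [hb, htS' (ε / 3) (by positivity)] with k hk hkt
  rw [dist_zero_right] at hkt ⊢
  have h1 : ‖curvDistribution r sch k p (linActMulti (planeRot (0 : Fin 3) t₀) F) -
      curvDistribution r sch k p (linActMulti (planeRot (0 : Fin 3) t) F)‖ < ε / 3 := by
    rw [← curvDistribution_sub]
    refine (hk p _ hoff).trans_lt (lt_of_le_of_lt ?_ ht)
    rw [← mul_assoc]
    exact mul_le_mul_of_nonneg_right (le_abs_self _) (schwartzNorm_nonneg _ _)
  calc ‖curvDistribution r sch k p (linActMulti (planeRot (0 : Fin 3) t₀) F) - curvDistribution r sch k p F‖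
      = ‖(curvDistribution r sch k p (linActMulti (planeRot (0 : Fin 3) t₀) F) -
            curvDistribution r sch k p (linActMulti (planeRot (0 : Fin 3) t) F)) +
          (curvDistribution r sch k p (linActMulti (planeRot (0 : Fin 3) t) F) - curvDistribution r sch k p F)‖ := by
        congr 1; ring
    _ ≤ _ := norm_add_le _ _
    _ < ε / 3 + ε / 3 := add_lt_add h1 hkt
    _ ≤ ε := by linarith

end Pred

/-! ## §3 The registered stub -/

/-- `stub_rotOfPythagorean` — **(ROT) from (ROT₃₄₅), (UUVB) and the two glue statements** (registered glue stub of
stmt-QuantumFields-15828, line `Sketch`, reshape 16): asymptotic invariance of the canonical curvature distributions on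
`⁰𝒮` under the single Pythagorean rotation of the `(x⁰,x¹)`-plane (axis-vector form) implies asymptotic invariance
under every determinant-one isometry of `ℝ⁴`. The first two hypotheses are the statements of the landed
`stub_rotNiven` and `stub_rotHyper` verbatim. See the module docstring for the route. [folklore] -/
theorem stub_rotOfPythagorean :
    ∀ (G : Type) [Group G] [TopologicalSpace G] [IsTopologicalGroup G] [CompactSpace G]
      [MeasurableSpace G] [BorelSpace G] (r : LatticeRep G) (sch : SpeciesScheme (YMSpecies G)),
      (∀ (P : (EuclideanSpace ℝ (Fin 4) ≃ₗᵢ[ℝ] EuclideanSpace ℝ (Fin 4)) → Prop),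
        (∀ A B, P A → P B → P (A.trans B)) → (∀ A, P A → P A.symm) →
        P (LinearIsometryEquiv.refl ℝ (EuclideanSpace ℝ (Fin 4))) →
        IsClosed {t : ℝ | P (Literature.MathematicalPhysics.QuantumFieldTheory.planeRot (0 : Fin 3) t)} →
        (∃ θ : ℝ, Real.cos θ = 3 / 5 ∧ P (Literature.MathematicalPhysics.QuantumFieldTheory.planeRot (0 : Fin 3) θ)) →
        ∀ t : ℝ, P (Literature.MathematicalPhysics.QuantumFieldTheory.planeRot (0 : Fin 3) t)) →
      (∀ (P : (EuclideanSpace ℝ (Fin 4) ≃ₗᵢ[ℝ] EuclideanSpace ℝ (Fin 4)) → Prop),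
        (∀ A B, P A → P B → P (A.trans B)) → (∀ A, P A → P A.symm) →
        (∀ σ : Equiv.Perm (Fin 4), P (LinearIsometryEquiv.piLpCongrLeft 2 ℝ ℝ σ)) →
        (∀ t : ℝ, P (Literature.MathematicalPhysics.QuantumFieldTheory.planeRot (0 : Fin 3) t)) →
        ∀ A : EuclideanSpace ℝ (Fin 4) ≃ₗᵢ[ℝ] EuclideanSpace ℝ (Fin 4),
          (∀ i : Fin 4, ∃ j : Fin 4, A (EuclideanSpace.single i 1) = EuclideanSpace.single j 1 ∨
            A (EuclideanSpace.single i 1) = -EuclideanSpace.single j 1) → P A) →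
      Summit.QuantumFields.YangMills.Cruxes.ContinuumLimitOnTrajectory.TwoOrbitSynchronisation.UUVB r sch →
      (∀ R : EuclideanSpace ℝ (Fin 4) ≃ₗᵢ[ℝ] EuclideanSpace ℝ (Fin 4),
        R (EuclideanSpace.single 0 1) =
          (3 / 5 : ℝ) • EuclideanSpace.single 0 1 + (-(4 / 5) : ℝ) • EuclideanSpace.single 1 1 →
        R (EuclideanSpace.single 1 1) =
          (4 / 5 : ℝ) • EuclideanSpace.single 0 1 + (3 / 5 : ℝ) • EuclideanSpace.single 1 1 →
        R (EuclideanSpace.single 2 1) = EuclideanSpace.single 2 1 →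
        R (EuclideanSpace.single 3 1) = EuclideanSpace.single 3 1 →
        ∀ (p : ℕ) (F : SchwartzMap (Fin p → EuclideanSpace ℝ (Fin 4)) ℂ), IsOffDiagonal F →
          Tendsto (fun k : ℕ =>
            Summit.QuantumFields.YangMills.Cruxes.ContinuumLimitOnTrajectory.TwoOrbitSynchronisation.curvDistribution
                r sch k p (linActMulti R F) -
              Summit.QuantumFields.YangMills.Cruxes.ContinuumLimitOnTrajectory.TwoOrbitSynchronisation.curvDistribution
                r sch k p F) atTop (𝓝 0)) →
      ∀ (p : ℕ) (F : SchwartzMap (Fin p → EuclideanSpace ℝ (Fin 4)) ℂ), IsOffDiagonal F →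
        ∀ R : EuclideanSpace ℝ (Fin 4) ≃ₗᵢ[ℝ] EuclideanSpace ℝ (Fin 4),
          LinearMap.det (R.toLinearEquiv : EuclideanSpace ℝ (Fin 4) →ₗ[ℝ] EuclideanSpace ℝ (Fin 4)) = 1 →
            Tendsto (fun k : ℕ =>
              Summit.QuantumFields.YangMills.Cruxes.ContinuumLimitOnTrajectory.TwoOrbitSynchronisation.curvDistribution
                  r sch k p (linActMulti R F) -
                Summit.QuantumFields.YangMills.Cruxes.ContinuumLimitOnTrajectory.TwoOrbitSynchronisation.curvDistribution
                  r sch k p F) atTop (𝓝 0) := by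
  intro G _ _ _ _ _ _ r sch hNiven hHyper hU h345 p F hF R hR
  -- the asymptotic-invariance predicate
  let P : (EuclideanSpace ℝ (Fin 4) ≃ₗᵢ[ℝ] EuclideanSpace ℝ (Fin 4)) → Prop := fun A =>
    ∀ (p : ℕ) (F : 𝓢((Fin p → EuclideanSpace ℝ (Fin 4)), ℂ)), IsOffDiagonal F →
      Tendsto (fun k : ℕ => curvDistribution r sch k p (linActMulti A F) - curvDistribution r sch k p F) atTop (𝓝 0)
  have hmul : ∀ A B, P A → P B → P (A.trans B) := fun A B hA hB => pred_mul r sch hA hB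
  have hinv : ∀ A, P A → P A.symm := fun A hA => pred_symm r sch hA
  have hone : P (LinearIsometryEquiv.refl ℝ (EuclideanSpace ℝ (Fin 4))) := fun p F _ => pred_refl r sch p F
  have hperm : ∀ σ : Equiv.Perm (Fin 4), P (LinearIsometryEquiv.piLpCongrLeft 2 ℝ ℝ σ) := fun σ p F _ =>
    pred_perm r sch σ p F
  have hclosed : IsClosed {t : ℝ | P (planeRot (0 : Fin 3) t)} := isClosed_angleSet r sch hU
  -- the Pythagorean angle
  obtain ⟨θ, hc, hs⟩ := exists_cos_eq_and_sin_eq_neg (a := 3 / 5) (b := -(4 / 5)) (by norm_num)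
  have hθ : P (planeRot (0 : Fin 3) θ) := by
    intro q F' hF'
    refine h345 (planeRot (0 : Fin 3) θ) ?_ ?_ (rho_e2 θ) (rho_e3 θ) q F' hF'
    · rw [rho_e0 θ, hc, hs]; norm_num
    · rw [rho_e1 θ, hc, hs]; norm_num
  -- all angles, all signed permutations, all of `SO(4)`
  have hrho : ∀ t : ℝ, P (planeRot (0 : Fin 3) t) := hNiven P hmul hinv hone hclosed ⟨θ, hc, hθ⟩
  have hhyper : ∀ A : EuclideanSpace ℝ (Fin 4) ≃ₗᵢ[ℝ] EuclideanSpace ℝ (Fin 4),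
      LinearMap.det (A.toLinearEquiv : EuclideanSpace ℝ (Fin 4) →ₗ[ℝ] EuclideanSpace ℝ (Fin 4)) = 1 →
      (∀ i : Fin 4, ∃ j : Fin 4, A (EuclideanSpace.single i 1) = EuclideanSpace.single j 1 ∨
        A (EuclideanSpace.single i 1) = -EuclideanSpace.single j 1) → P A :=
    fun A _ hA => hHyper P hmul hinv hperm hrho A hA
  exact PlanarToEuclidean.so4_generation P hmul hinv hhyper (planar_of_rho P hmul hhyper hrho) R hR p F hF

end Summit.QuantumFields.YangMills.Theorems.ContinuumLegGivenGap

end
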